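import Summits.AtomisticToContinuum.HydrodynamicLimit.Theses.OneFlightGossipEngine
import Summits.AtomisticToContinuum.HydrodynamicLimit.Theorems.OneFlightGossipEngineKineticCurrentsWindowLDUniformLedgerAssembly
import Summits.AtomisticToContinuum.HydrodynamicLimit.Theorems.OneFlightGossipEngineKineticCurrentsWindowLDUniformCanonicalProxy
import Summits.AtomisticToContinuum.HydrodynamicLimit.Theorems.OneFlightGossipEngineKineticCurrentsWindowLDUniformForecastIncrement
import Summits.AtomisticToContinuum.HydrodynamicLimit.Theorems.OneFlightGossipEngineKineticCurrentsWindowLDUniformCanonicalSummable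

/-!
# Skeleton — crux `KineticCurrentsWindowLDUniform` (stmt-AtomisticToContinuum-14662), line `gossip-forecast-ledger`

Crux-plan skeleton for the triage-passed idea `gossip-forecast-ledger` (Ideas/gossip-forecast-ledger.md,
ideator 1; TRIAGE-r1-1 / TRIAGE-r1-2: pass with sharpenings), RESHAPED to answer the panel:

* ONE FIXED REFERENCE. The ledger's reference law is the crux's own local Gibbs law `λ = λ_loc`
  (continuous profiles) — no Csiszár / I-projection onto rough local-equilibrium data (TRIAGE-r1-2
  objection (1)–(2): "K2 false for drifted LE starts", "the LE sector is dynamical at mesoscopic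
  scales", "the forecast given a sparse group's history INFERS the drift"). The hydrodynamic (LE)
  sector is carried HONESTLY by the inference channel of the forecast martingale: it sits inside the
  predictable proxy `V` of `stub_qvMoment`, whose exponential moment under `λ` is a static Gaussian
  (cell-momentum `χ²`) computation — this is where `β₀` comes from, STATIC as Disproof §3
  (`not_kineticCurrentsWindowLDUniformAllBeta`, `tilt_window_lower_bound`) demands: the consistency
  chase of TRIAGE-r1-2 shows `lam`, `κ`, `α` below can only be `O(1/(θ λ_max(A))²)`, never `∝ τ`.
* TWO HALVES, NOT `m` SPARSE GROUPS. The "sparse tagged group" is a half `S` (`2|S| ≤ N+2`) and its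
  complement; the group kick filtration `ℱ_n = σ(z_S(0), (t_k, z_S(t_k))_{k<n})` reveals the group's
  states at its first `n` collision moments in chronological order (`t_k` = `k`-th element of
  `⋃_{i∈S} collisionTimesOf`, via the tree's `nthTimeAfter`; guarded by `z ∈ good`), so between
  revealed moments the group flies freely and `X_S` is `⨆ℱ`-measurable (`stub_kickFiltration`).
  No Hölder inflation of `β`: the two halves' ledgers ADD.
* JUNK-FREE FORMS. Conditional MGF domination is stated through set integrals over `ℱ_k`-sets
  (`∫⁻_s e^{α d − α²V/2} ≤ μ s`), not through `condExp` of a possibly non-integrable exponential;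
  summability of `V` is asserted a.e.; all moment bounds are `∫⁻ … ofReal (exp …)`.

Composition (`KineticCurrentsWindowLDUniform_of = stub_ledgerAssembly S1 S2 S3 S4`):

1. `stub_kickFiltration` (S1, technical, provable M–L): the group kick filtration is Borel and the
   group's window functional is a.e. measurable for its limit σ-algebra (joint measurability of the
   flow on the good set + measurability of collision times + free flight between revealed moments).
2. `stub_entropyLedger` (S2, abstract, provable M–L, pure Mathlib): for `Q ≪ P`, a filtration `ℱ`, an
   integrable `X` measurable for `⨆ℱ`, forecasts `f_n = P[X|ℱ n]` and a predictable proxy `V ≥ 0`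
   with `E_P[e^{α(f_{k+1}−f_k) − α²V_k/2} | ℱ_k] ≤ 1`:
   `E_Q X − E_Q f_0 ≤ KL(Q‖P)/α + (α/2) E_Q Σ_k V_k`
   (exponential supermartingale + Lévy upward + Fatou + the Donsker–Varadhan entropy inequality —
   the "chain rule + fibrewise entropy inequality" of the card in one stroke).
3. `stub_forecastMoment` (S3 = K2, dynamical, open): the INITIAL forecast `f_0^S = λ[X_S | z_S(0)]`
   has an `N`-uniform exponential moment `log ∫ e^{κ f_0^S} dλ ≤ (N+1)(C₂/τ + δ)` at a static `κ > 0`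
   (first-moment flavour: predictability horizon of a few mean free times ⇒ `f_0 ≈ (C/τ')(1+|w|²)`
   per particle; drifted configurations priced by their own improbability for `κ < 4/(2θλ_max)`).
   FALSE for the free gas (`f_0 = X_S`, static pressure) — collisions enter here (Disproof §1).
4. `stub_qvMoment` (S4 = K3, dynamical, HARDEST, open): the forecast increments along `ℱ` admit a
   predictable proxy `V` dominating their conditional MGF at a static `α`, with
   `log ∫ e^{lam Σ_k V_k} dλ ≤ (N+1)(C₃/τ + δ)` at a static `lam` (kinetic part `~ 1/τ'` per particle:
   one kick moves the window forecast by `ℓ|w|/h`, fast particles thermalise geometrically; inference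
   part: cell-momentum `χ²`, `O(#cells) = o(N)`).
5. `stub_ledgerAssembly` (S5, provable M–L): `Q := λ.tilted (βX)`, `log ∫ e^{βX} dλ = β E_Q X − KL(Q‖λ)`
   (tree `tilted_klDiv_toReal_eq` pattern, extended to quadratic growth via the landed
   `stub_fibreExpMoment` of line `Sketch`), `X = X_S + X_{Sᶜ}`, S2 on each half with S1/S4, the
   entropy inequality `E_Q Y ≤ (KL + log E_λ e^{lam Y})/lam` on `f_0` (S3) and `ΣV` (S4), sign flip
   `(A,b) ↦ (−A,−b)` for `β < 0`, and `β₀ := min(static threshold, 1/(2(1/κ + 1/α + α/(2 lam))))`: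
   `β E_Q X − KL ≤ 2β[(N+1)(C₂/τ+δ)/κ + (α/(2 lam))(N+1)(C₃/τ+δ)] ≤ ε(N+1)`.

Disproof.lean (cycle 1) honoured: §1 (`N₀` load-bearing) — S3/S4 carry `∃ N₀` and S3 is false for
the free gas; §3 (`β₀` static) — `β₀` is a function of `κ, α, lam`, the growth constant and `sup θ₀`,
all fixed before `τ`; §4 (`⊥ v_j` load-bearing) — S3/S4 carry the three orthogonality clauses
verbatim (without them `E_λ X ≠ o(N)` and S3 fails); §2 (`⊥‖v‖²` redundant) — kept verbatim, unused.
No landed `Negative/` lemma is an instance of S1–S4 (they are quantifier-strengthenings of the crux).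
-/

noncomputable section

open MeasureTheory Set Filter InformationTheory
open scoped ENNReal Topology Classical ProbabilityTheory

namespace Summit.AtomisticToContinuum.HydrodynamicLimit.Cruxes.KineticCurrentsWindowLDUniform.GossipForecastLedger

open Literature.Analysis.FluidPDE (HardSphereFlow Config localMaxwellian collisionTimesOf nthTimeAfter)
open Literature.MathematicalPhysics.KineticTheory (T3 V3 hsDiameter localGibbsLaw)
open Summit.AtomisticToContinuum.HydrodynamicLimit.Theses.OneFlightGossipEngine
  (KineticCurrentsWindowLDUniform)

/-! ## Stubs (signatures fully expanded over tree vocabulary; `let`s are part of the signature text) -/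



/-- S3 = K2 — EXPONENTIAL MOMENT OF THE INITIAL FORECAST (dynamical, open; first-moment flavour).
Under the crux's local Gibbs law the forecast of a half's window functional GIVEN THAT HALF'S INITIAL DATA,
`f_0^S = λ[X_S | σ(z_S(0))]` (`ℱ 0` below), satisfies `log ∫ e^{κ f_0^S} dλ ≤ (N+1)(C₂/τ + δ)` for a
static `κ > 0` and all large `N`: knowing half the initial data predicts a tagged particle only up to a
few mean free times (`|f_0| ≲ (C/τ')(1+|w|²)` per particle on typical data), and atypical (e.g. drifted)
half-configurations are paid by their own `λ`-improbability as long as `κ < 1/(θ_max λ_max(A_sym))`-ish —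
the static origin of `β₀` (Disproof §3). FALSE without collisions (free gas: `f_0^S = X_S`, the bound
would be the static pressure; Disproof §1) and without `⊥ 1, v_j` (then `E_λ X_S ≠ o(N)`; Disproof §4). -/
theorem stub_forecastMoment :
    ∃ η₀ : ℝ, 0 < η₀ ∧ ∀ (a θ₀ : T3 → ℝ) (u₀ : T3 → V3), Continuous a → Continuous θ₀ → Continuous u₀ →
      (∀ x, 0 < a x) → (∀ x, 0 < θ₀ x) → ∀ σ : ℝ, 0 < σ → σ ^ 3 * (⨆ x, a x) ≤ η₀ * ∫ x, a x →
      ∀ Φ : (N : ℕ) → HardSphereFlow (Literature.Analysis.FluidPDE.Torus.geometry (Fin 3)) (hsDiameter σ N) (N + 1),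
      ∀ (A : T3 → Fin 3 → Fin 3 → ℝ) (b : T3 → V3) (G : T3 × ℝ → ℝ),
      Continuous A → Continuous b → Continuous G →
      ∀ (F : T3 × V3 → ℝ), (∀ y, F y =
        (∑ j : Fin 3, ∑ k : Fin 3, A y.1 j k * ((y.2 - u₀ y.1) j * (y.2 - u₀ y.1) k)) +
          (∑ j : Fin 3, b y.1 j * (y.2 - u₀ y.1) j) * G (y.1, ‖y.2 - u₀ y.1‖ ^ 2)) →
      ∀ C : ℝ, (∀ y, |F y| ≤ C * (1 + ‖y.2‖ ^ 2)) →
      (∀ x, ∫ v, F (x, v) * localMaxwellian 1 (θ₀ x) (u₀ x) v = 0) →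
      (∀ x (j : Fin 3), ∫ v, F (x, v) * v j * localMaxwellian 1 (θ₀ x) (u₀ x) v = 0) →
      (∀ x, ∫ v, F (x, v) * ‖v‖ ^ 2 * localMaxwellian 1 (θ₀ x) (u₀ x) v = 0) →
      ∃ κ : ℝ, 0 < κ ∧ ∃ C₂ : ℝ, ∀ τ : ℝ, 0 < τ → ∀ δ : ℝ, 0 < δ → ∃ N₀ : ℕ, ∀ N : ℕ, N₀ ≤ N →
      ∀ S : Finset (Fin (N + 1)), 2 * S.card ≤ N + 2 →
      let μ : Measure (Config (N + 1) (Fin 3) T3) := localGibbsLaw σ a u₀ θ₀ N (Φ N)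
      let X : Config (N + 1) (Fin 3) T3 → ℝ := fun z => ∑ i ∈ S, (τ * ((N : ℝ) + 1) ^ (-(1 / 3 : ℝ)))⁻¹ * ∫ r in (0 : ℝ)..(τ * ((N : ℝ) + 1) ^ (-(1 / 3 : ℝ))), F (((Φ N).flow r z) i)
      let T : Config (N + 1) (Fin 3) T3 → Set ℝ := fun z =>
        ⋃ i ∈ S, collisionTimesOf (Literature.Analysis.FluidPDE.Torus.geometry (Fin 3)) (hsDiameter σ N) (fun t => (Φ N).flow t z) i
      let tk : ℕ → Config (N + 1) (Fin 3) T3 → ℝ := fun k z => if z ∈ (Φ N).good then nthTimeAfter (T z) 0 k else 0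
      let ℱ : ℕ → MeasurableSpace (Config (N + 1) (Fin 3) T3) := fun n =>
        MeasurableSpace.comap (fun (z : Config (N + 1) (Fin 3) T3) (i : S) => z i.1) inferInstance ⊔
          ⨆ k < n, MeasurableSpace.comap (fun (z : Config (N + 1) (Fin 3) T3) => (tk k z, fun i : S => (Φ N).flow (tk k z) z i.1))
            inferInstance
      ∫⁻ z, ENNReal.ofReal (Real.exp (κ * (μ[X|ℱ 0]) z)) ∂μ ≤
        ENNReal.ofReal (Real.exp ((C₂ / τ + δ) * ((N : ℝ) + 1))) := by
  sorry




/-- S4c = K3 IN CANONICAL FORM — THE LINE'S HARDEST (open, dynamical) STUB. Same frame as K2; the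
predictable quadratic-variation proxy is now the CANONICAL one,
`V_k = (2/α²)·max(0, log μ[e^{α(f_{k+1}−f_k)} | ℱ k])` (the minimal valid proxy: any `V` with the
set-integral domination is `≥` it a.e.), so the statement has no existential softness left: at a static
`α ≤ 1/(16·max(C,1)·sup θ₀)` and a static `lam > 0`, `log ∫ e^{lam Σ_k V_k} dμ ≤ (N+1)(C₃/τ + δ)` for all
large `N`, uniformly over halves `S` (`Σ_k V_k` is a.e. a finite sum by the landed S4d `…Gossip.stub_qvCanonicalSummable`, p108597, so `∑'` is the honest sum). Content as
for S4: one kick moves the window forecast of a particle of peculiar speed `|w|` by `≈ ℓ|w|/w_N`; fast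
particles thermalise geometrically; the inference channel is a cell-momentum `χ²` of size `o(N)`. FALSE for
the free gas / one sphere (Disproof §1: no kicks, `V ≡ 0` but then K2 fails — K2 and K3 are BOTH needed). -/
theorem stub_qvMomentCanonical :
    ∃ η₀ : ℝ, 0 < η₀ ∧ η₀ ≤ 1 / 8 ∧ ∀ (a θ₀ : T3 → ℝ) (u₀ : T3 → V3), Continuous a → Continuous θ₀ → Continuous u₀ →
      (∀ x, 0 < a x) → (∀ x, 0 < θ₀ x) → ∀ σ : ℝ, 0 < σ → σ ^ 3 * (⨆ x, a x) ≤ η₀ * ∫ x, a x →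
      ∀ Φ : (N : ℕ) → HardSphereFlow (Literature.Analysis.FluidPDE.Torus.geometry (Fin 3)) (hsDiameter σ N) (N + 1),
      ∀ (A : T3 → Fin 3 → Fin 3 → ℝ) (b : T3 → V3) (G : T3 × ℝ → ℝ),
      Continuous A → Continuous b → Continuous G →
      ∀ (F : T3 × V3 → ℝ), (∀ y, F y =
        (∑ j : Fin 3, ∑ k : Fin 3, A y.1 j k * ((y.2 - u₀ y.1) j * (y.2 - u₀ y.1) k)) +
          (∑ j : Fin 3, b y.1 j * (y.2 - u₀ y.1) j) * G (y.1, ‖y.2 - u₀ y.1‖ ^ 2)) →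
      ∀ C : ℝ, (∀ y, |F y| ≤ C * (1 + ‖y.2‖ ^ 2)) →
      (∀ x, ∫ v, F (x, v) * localMaxwellian 1 (θ₀ x) (u₀ x) v = 0) →
      (∀ x (j : Fin 3), ∫ v, F (x, v) * v j * localMaxwellian 1 (θ₀ x) (u₀ x) v = 0) →
      (∀ x, ∫ v, F (x, v) * ‖v‖ ^ 2 * localMaxwellian 1 (θ₀ x) (u₀ x) v = 0) →
      ∃ α : ℝ, 0 < α ∧ α * (16 * max C 1 * ⨆ x, θ₀ x) ≤ 1 ∧ ∃ lam : ℝ, 0 < lam ∧ ∃ C₃ : ℝ,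
      ∀ τ : ℝ, 0 < τ → ∀ δ : ℝ, 0 < δ → ∃ N₀ : ℕ, ∀ N : ℕ, N₀ ≤ N →
      ∀ S : Finset (Fin (N + 1)), 2 * S.card ≤ N + 2 →
      let μ : Measure (Config (N + 1) (Fin 3) T3) := localGibbsLaw σ a u₀ θ₀ N (Φ N)
      let X : Config (N + 1) (Fin 3) T3 → ℝ := fun z => ∑ i ∈ S, (τ * ((N : ℝ) + 1) ^ (-(1 / 3 : ℝ)))⁻¹ * ∫ r in (0 : ℝ)..(τ * ((N : ℝ) + 1) ^ (-(1 / 3 : ℝ))), F (((Φ N).flow r z) i)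
      let T : Config (N + 1) (Fin 3) T3 → Set ℝ := fun z =>
        ⋃ i ∈ S, collisionTimesOf (Literature.Analysis.FluidPDE.Torus.geometry (Fin 3)) (hsDiameter σ N) (fun t => (Φ N).flow t z) i
      let tk : ℕ → Config (N + 1) (Fin 3) T3 → ℝ := fun k z => if z ∈ (Φ N).good then nthTimeAfter (T z) 0 k else 0
      let ℱ : ℕ → MeasurableSpace (Config (N + 1) (Fin 3) T3) := fun n =>
        MeasurableSpace.comap (fun (z : Config (N + 1) (Fin 3) T3) (i : S) => z i.1) inferInstance ⊔
          ⨆ k < n, MeasurableSpace.comap (fun (z : Config (N + 1) (Fin 3) T3) => (tk k z, fun i : S => (Φ N).flow (tk k z) z i.1))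
            inferInstance
      let V : ℕ → Config (N + 1) (Fin 3) T3 → ℝ := fun k z =>
        2 / α ^ 2 * max 0 (Real.log ((μ[fun z => Real.exp (α * ((μ[X|ℱ (k + 1)]) z - (μ[X|ℱ k]) z))|ℱ k]) z))
      ∫⁻ z, ENNReal.ofReal (Real.exp (lam * ∑' k, V k z)) ∂μ ≤
        ENNReal.ofReal (Real.exp ((C₃ / τ + δ) * ((N : ℝ) + 1))) := by
  sorry

/-- S4 = K3 — PREDICTABLE QUADRATIC VARIATION OF THE FORECAST HAS AN `N`-UNIFORM EXPONENTIAL MOMENT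
UNDER THE UNTILTED LAW (dynamical, the line's HARDEST stub). Along the group kick filtration `ℱ` the
forecast martingale `f_n = λ[X_S | ℱ n]` admits a predictable proxy `V_k ≥ 0` (`ℱ_k`-measurable, a.e.
summable) dominating the conditional moment generating function of its increments at a STATIC `α`
(set-integral form: `∫_s e^{α(f_{k+1}−f_k) − α²V_k/2} dλ ≤ λ(s)` for `s ∈ ℱ_k`), and
`log ∫ e^{lam Σ_k V_k} dλ ≤ (N+1)(C₃/τ + δ)` at a STATIC `lam`. Content: one kick moves the window
forecast of a particle of peculiar speed `|w|` by `≈ ℓ|w|/h` (closed-form for the traceless stress by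
the route's `GossipStressIdentity`, `2/3`-damped for the heat flux by `KacPairHeatFlux`), fast particles
thermalise geometrically, so the kinetic part of `Σ_k V_k` is `≈ |w|²/τ'²·#kicks ≈ 1/τ'` per particle; the
inference part (the forecast learns mesoscopic drifts from the revealed partners — TRIAGE-r1-2) is a
cell-momentum `χ²` whose `λ`-exponential moment is finite iff `lam ≲ 1/(θ λ_max)²` and contributes
`O(#cells) = o(N)`. `OneFlightLayeredChaos` (14535) enters multiplicatively in the contraction per kick. -/
theorem stub_qvMoment :
    ∃ η₀ : ℝ, 0 < η₀ ∧ ∀ (a θ₀ : T3 → ℝ) (u₀ : T3 → V3), Continuous a → Continuous θ₀ → Continuous u₀ →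
      (∀ x, 0 < a x) → (∀ x, 0 < θ₀ x) → ∀ σ : ℝ, 0 < σ → σ ^ 3 * (⨆ x, a x) ≤ η₀ * ∫ x, a x →
      ∀ Φ : (N : ℕ) → HardSphereFlow (Literature.Analysis.FluidPDE.Torus.geometry (Fin 3)) (hsDiameter σ N) (N + 1),
      ∀ (A : T3 → Fin 3 → Fin 3 → ℝ) (b : T3 → V3) (G : T3 × ℝ → ℝ),
      Continuous A → Continuous b → Continuous G →
      ∀ (F : T3 × V3 → ℝ), (∀ y, F y =
        (∑ j : Fin 3, ∑ k : Fin 3, A y.1 j k * ((y.2 - u₀ y.1) j * (y.2 - u₀ y.1) k)) +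
          (∑ j : Fin 3, b y.1 j * (y.2 - u₀ y.1) j) * G (y.1, ‖y.2 - u₀ y.1‖ ^ 2)) →
      ∀ C : ℝ, (∀ y, |F y| ≤ C * (1 + ‖y.2‖ ^ 2)) →
      (∀ x, ∫ v, F (x, v) * localMaxwellian 1 (θ₀ x) (u₀ x) v = 0) →
      (∀ x (j : Fin 3), ∫ v, F (x, v) * v j * localMaxwellian 1 (θ₀ x) (u₀ x) v = 0) →
      (∀ x, ∫ v, F (x, v) * ‖v‖ ^ 2 * localMaxwellian 1 (θ₀ x) (u₀ x) v = 0) →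
      ∃ α : ℝ, 0 < α ∧ ∃ lam : ℝ, 0 < lam ∧ ∃ C₃ : ℝ, ∀ τ : ℝ, 0 < τ → ∀ δ : ℝ, 0 < δ → ∃ N₀ : ℕ, ∀ N : ℕ, N₀ ≤ N →
      ∀ S : Finset (Fin (N + 1)), 2 * S.card ≤ N + 2 →
      let μ : Measure (Config (N + 1) (Fin 3) T3) := localGibbsLaw σ a u₀ θ₀ N (Φ N)
      let X : Config (N + 1) (Fin 3) T3 → ℝ := fun z => ∑ i ∈ S, (τ * ((N : ℝ) + 1) ^ (-(1 / 3 : ℝ)))⁻¹ * ∫ r in (0 : ℝ)..(τ * ((N : ℝ) + 1) ^ (-(1 / 3 : ℝ))), F (((Φ N).flow r z) i)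
      let T : Config (N + 1) (Fin 3) T3 → Set ℝ := fun z =>
        ⋃ i ∈ S, collisionTimesOf (Literature.Analysis.FluidPDE.Torus.geometry (Fin 3)) (hsDiameter σ N) (fun t => (Φ N).flow t z) i
      let tk : ℕ → Config (N + 1) (Fin 3) T3 → ℝ := fun k z => if z ∈ (Φ N).good then nthTimeAfter (T z) 0 k else 0
      let ℱ : ℕ → MeasurableSpace (Config (N + 1) (Fin 3) T3) := fun n =>
        MeasurableSpace.comap (fun (z : Config (N + 1) (Fin 3) T3) (i : S) => z i.1) inferInstance ⊔
          ⨆ k < n, MeasurableSpace.comap (fun (z : Config (N + 1) (Fin 3) T3) => (tk k z, fun i : S => (Φ N).flow (tk k z) z i.1))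
            inferInstance
      ∃ V : ℕ → Config (N + 1) (Fin 3) T3 → ℝ,
        (∀ k z, 0 ≤ V k z) ∧ (∀ k, Measurable[ℱ k] (V k)) ∧ (∀ᵐ z ∂μ, Summable (fun k => V k z)) ∧
        (∀ (k : ℕ) (s : Set (Config (N + 1) (Fin 3) T3)), MeasurableSet[ℱ k] s →
          ∫⁻ z in s, ENNReal.ofReal (Real.exp (α * ((μ[X|ℱ (k + 1)]) z - (μ[X|ℱ k]) z) - α ^ 2 * V k z / 2)) ∂μ
            ≤ μ s) ∧
        ∫⁻ z, ENNReal.ofReal (Real.exp (lam * ∑' k, V k z)) ∂μ ≤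
          ENNReal.ofReal (Real.exp ((C₃ / τ + δ) * ((N : ℝ) + 1))) := by
  -- K3 from its canonical form (S4c) through the LANDED abstract proxy lemma (S4a `…Gossip.stub_canonicalProxy`,
  -- p107052), the LANDED static integrability (S4b `…Gossip.stub_forecastIncrementExpIntegrable`, p107149) and the
  -- LANDED kick-filtration measurability (S1 `…Gossip.stub_kickFiltration`, p101198); a.e. summability from the LANDED S4d `…Gossip.stub_qvCanonicalSummable` (p108597).
  obtain ⟨η₀, hη₀, hη8, H⟩ := stub_qvMomentCanonical
  refine ⟨η₀, hη₀, ?_⟩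
  intro a θ₀ u₀ ha hθ hu ha0 hθ0 σ hσ hguard Φ A b G hA hb hG F hF C hC h1 hv h2
  obtain ⟨α, hα, hαle, lam, hlam, C₃, H⟩ :=
    H a θ₀ u₀ ha hθ hu ha0 hθ0 σ hσ hguard Φ A b G hA hb hG F hF C hC h1 hv h2
  refine ⟨α, hα, lam, hlam, C₃, ?_⟩
  intro τ hτ δ hδ
  obtain ⟨N₀, H⟩ := H τ hτ δ hδ
  refine ⟨N₀, ?_⟩
  intro N hN S hS
  have hmom := H N hN S hS
  -- the activity guard with `η₀ ≤ 1/8` gives `σ ≤ 1/2`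
  have hint_le : ∫ x, a x ≤ ⨆ x, a x :=
    Summit.AtomisticToContinuum.HydrodynamicLimit.Theorems.KineticCurrentsWindowLDUniformSketch.integral_le_iSup_T3 ha
  have hint_nn : 0 ≤ ∫ x, a x := integral_nonneg fun x => (ha0 x).le
  have hsup_pos : 0 < ⨆ x, a x :=
    lt_of_lt_of_le (ha0 0) (le_ciSup (isCompact_range ha).bddAbove 0)
  have hσ2 : σ ≤ 1 / 2 := by
    have h8 : σ ^ 3 * (⨆ x, a x) ≤ 1 / 8 * (⨆ x, a x) :=
      hguard.trans ((mul_le_mul_of_nonneg_right hη8 hint_nn).trans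
        (mul_le_mul_of_nonneg_left hint_le (by norm_num)))
    have h8' : σ ^ 3 ≤ (1 / 2) ^ 3 := by nlinarith
    exact le_of_pow_le_pow_left₀ (by norm_num) (by norm_num) h8'
  have hFc : Continuous F := by
    have hFeq : F = fun y : T3 × V3 =>
        (∑ j : Fin 3, ∑ k : Fin 3, A y.1 j k * ((y.2 - u₀ y.1) j * (y.2 - u₀ y.1) k)) +
          (∑ j : Fin 3, b y.1 j * (y.2 - u₀ y.1) j) * G (y.1, ‖y.2 - u₀ y.1‖ ^ 2) := funext hF
    rw [hFeq]
    fun_prop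
  haveI := Literature.MathematicalPhysics.KineticTheory.isProbabilityMeasure_localGibbsLaw ha hθ hu ha0 hθ0 hσ2 N (Φ N)
  have hle := (Summit.AtomisticToContinuum.HydrodynamicLimit.Theorems.KineticCurrentsWindowLDUniformGossip.stub_kickFiltration
    σ hσ a θ₀ u₀ N (Φ N) F hFc τ hτ S).1
  have hexp := Summit.AtomisticToContinuum.HydrodynamicLimit.Theorems.KineticCurrentsWindowLDUniformGossip.stub_forecastIncrementExpIntegrable a θ₀ u₀ ha hθ hu ha0 hθ0 σ hσ hσ2 N (Φ N) F hFc C hC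
    α hα hαle τ hτ S
  have hP := Summit.AtomisticToContinuum.HydrodynamicLimit.Theorems.KineticCurrentsWindowLDUniformGossip.stub_canonicalProxy (Config (N + 1) (Fin 3) T3) (localGibbsLaw σ a u₀ θ₀ N (Φ N)) _ hle _ α hα hexp
  have hsum := Summit.AtomisticToContinuum.HydrodynamicLimit.Theorems.KineticCurrentsWindowLDUniformGossip.stub_qvCanonicalSummable a θ₀ u₀ ha hθ hu ha0 hθ0 σ hσ hσ2 N (Φ N) F hFc C hC α hα hαle τ hτ S
  exact ⟨_, hP.1, hP.2.1, hsum, hP.2.2, hmom⟩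



/-! ## Composition -/

/-- The line closes the crux modulo its two dynamical stubs: the LANDED assembly
(`KineticCurrentsWindowLDUniformGossip.stub_ledgerAssembly`, p105461) applied to the LANDED kick-filtration
measurability (`…Gossip.stub_kickFiltration`, p101198), the LANDED entropy ledger (`…Gossip.stub_entropyLedger`,
p97055) and the two dynamical inputs K2 = `stub_forecastMoment` (registered, open) and K3 = `stub_qvMoment`, the latter
DERIVED here from its canonical form `stub_qvMomentCanonical` (registered, open) via the LANDED
`…Gossip.stub_canonicalProxy` (p107052), `…Gossip.stub_forecastIncrementExpIntegrable` (p107149) and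
`…Gossip.stub_qvCanonicalSummable` (p108597). Equivalently
`KineticCurrentsWindowLDUniformGossip.stub_ledgerAssembly_of_moments stub_forecastMoment stub_qvMoment`
(the transfer `K2 ∧ K3 ⟹ crux`, in the tree). -/
theorem KineticCurrentsWindowLDUniform_of : KineticCurrentsWindowLDUniform :=
  Summit.AtomisticToContinuum.HydrodynamicLimit.Theorems.KineticCurrentsWindowLDUniformGossip.stub_ledgerAssembly
    Summit.AtomisticToContinuum.HydrodynamicLimit.Theorems.KineticCurrentsWindowLDUniformGossip.stub_kickFiltration
    Summit.AtomisticToContinuum.HydrodynamicLimit.Theorems.KineticCurrentsWindowLDUniformGossip.stub_entropyLedger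
    stub_forecastMoment stub_qvMoment

end Summit.AtomisticToContinuum.HydrodynamicLimit.Cruxes.KineticCurrentsWindowLDUniform.GossipForecastLedger
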